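import Mathlib

/-!
# Crux `TateFamilyKernel` (stmt-KontsevichZagierPeriods-9130), line `Sketch` — `stub_eulerTower`
# (wave 13, the multi-weight Euler telescoper: the lead's tower identity)

For the Euler sector of the lead's skeleton of the crux
`Summit.KontsevichZagierPeriods.KontsevichZagierPeriods.Theses.InverseLandau.TateFamilyKernel`
(quasi-homogeneous pencils `Q = 1 − ϖT`), the per-weight reductions (A)+(B) leave the band
`Σ_w t^{λ_w−1}·ĵ_w` on the `(s,t)`-square, while only the TELESCOPED face family
`ĵ_L = Σ_w ∏_{v≠w}(λ_v + δ) ĵ_w` (`δ = t∂_t`) has vanishing face integrals. The identity proved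
here converts one into the other modulo an exact `t`-derivative with vanishing face values:

* Euler-operator rule: for a `δ`-tower `h_{i+1} = t·h_i'` and `e = Σ_i e_i X^i`,
  `t^m·Σ_i e_i h_i = e(−m−1)·t^m h_0 + ∂_t(t^{m+1}·Σ_j q_j h_j)`, `q_j = Σ_{i>j} e_i (−m−1)^{i−1−j}`
  (`EulerTower.hasDerivAt_term`, from the reindexing identity `EulerTower.sum_quot_identity`);
* with `e = e_w := ∏_{v∈W∖w}(X + λ_v)` (`λ_v = v + c`), nodes `−λ_u` and `c_u := ∏_{v≠u}(λ_v − λ_u)`: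
  `e_w(−λ_u) = c_w·[u = w]`, so `K_w := Σ_u (t^{λ_u}/c_u)·Σ_j q^{(u)}_j h_j` has derivative
  `ε(t)·Σ_i e_{w,i} h_i − t^{λ_w−1} h_0`, `ε(t) = Σ_u t^{λ_u−1}/c_u`;
* `K_w(0) = 0` (`λ_u ≥ 1`) and `K_w(1) = 0`: `Σ_u q^{(u)}/c_u = 0`, i.e.
  `Σ_u (e − e(ν_u))/((X − ν_u)·∏_{v≠u}(ν_u − ν_v)) = 0` for `deg e < #W` — Lagrange interpolation
  (`Lagrange.sum_basis`, `Lagrange.eq_interpolate`) and `Polynomial.coeff_divByMonic_X_sub_C`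
  (`EulerTower.sum_C_mul_divByMonic_eq_zero`, `EulerTower.sum_quot_coeff_eq_zero`).

Mathlib only; no named fact, no new definition. Helpers live in the sub-namespace `EulerTower`.
-/

noncomputable section

open MeasureTheory Set MvPolynomial

namespace Summit.KontsevichZagierPeriods.InverseLandau.TateFamilyKernel.Descent

namespace EulerTower

/-- **Reindexing identity behind the Euler-operator rule.** For coefficients `a_i`, a sequence
`g_j` and a node `ν`: `Σ_{j<r} (Σ_{j<i<r} a_i ν^{i−1−j})·(g_{j+1} − ν g_j) = Σ_{i<r} a_i g_i − (Σ_{i<r} a_i ν^i)·g_0`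
(telescoping in `j`). [folklore] -/
theorem sum_quot_identity {R : Type*} [CommRing R] (a g : ℕ → R) (ν : R) (r : ℕ) :
    ∑ j ∈ Finset.range r, (∑ i ∈ Finset.Ioo j r, a i * ν ^ (i - 1 - j)) * (g (j + 1) - ν * g j) =
      ∑ i ∈ Finset.range r, a i * g i - (∑ i ∈ Finset.range r, a i * ν ^ i) * g 0 := by
  induction r with
  | zero => simp
  | succ r ih =>
    have hI : ∀ j, j < r → Finset.Ioo j (r + 1) = insert r (Finset.Ioo j r) := by
      intro j hj
      ext i
      simp only [Finset.mem_Ioo, Finset.mem_insert]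
      omega
    have hnot : ∀ j, r ∉ Finset.Ioo j r := fun j => by simp
    have hlast : Finset.Ioo r (r + 1) = ∅ := by
      ext i
      simp only [Finset.mem_Ioo, Finset.notMem_empty, iff_false]
      omega
    rw [Finset.sum_range_succ, hlast, Finset.sum_empty, zero_mul, add_zero]
    have hsplit : ∑ j ∈ Finset.range r, (∑ i ∈ Finset.Ioo j (r + 1), a i * ν ^ (i - 1 - j)) * (g (j + 1) - ν * g j) =
        ∑ j ∈ Finset.range r, (∑ i ∈ Finset.Ioo j r, a i * ν ^ (i - 1 - j)) * (g (j + 1) - ν * g j) +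
          a r * ∑ j ∈ Finset.range r, (ν ^ (r - 1 - j) * g (j + 1) - ν ^ (r - j) * g j) := by
      rw [Finset.mul_sum, ← Finset.sum_add_distrib]
      refine Finset.sum_congr rfl fun j hj => ?_
      rw [Finset.mem_range] at hj
      rw [hI j hj, Finset.sum_insert (hnot j)]
      have hpow : ν ^ (r - 1 - j) * ν = ν ^ (r - j) := by
        rw [← pow_succ]
        congr 1
        omega
      rw [← hpow]
      ring
    have htel : ∑ j ∈ Finset.range r, (ν ^ (r - 1 - j) * g (j + 1) - ν ^ (r - j) * g j) = g r - ν ^ r * g 0 := by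
      have h := Finset.sum_range_sub (fun j => ν ^ (r - j) * g j) r
      simp only [Nat.sub_self, Nat.sub_zero, pow_zero, one_mul] at h
      rw [← h]
      refine Finset.sum_congr rfl fun j _ => ?_
      rw [show r - 1 - j = r - (j + 1) by omega]
    rw [hsplit, htel, ih, Finset.sum_range_succ, Finset.sum_range_succ]
    ring

/-- **The Euler-operator rule as a derivative.** For a `δ`-tower `t·h_i' = h_{i+1}`,
coefficients `a_i` (`i < r`), `m : ℕ` and the node `ν = −(m+1)`, with `q_j = Σ_{j<i<r} a_i ν^{i−1−j}`:
`d/dt [t^{m+1}·Σ_{j<r} q_j h_j] = t^m·Σ_{i<r} a_i h_i − (Σ_{i<r} a_i ν^i)·t^m·h_0` at `t`.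
[folklore: `t^m(δ + m + 1)u = ∂_t(t^{m+1}u)`] -/
theorem hasDerivAt_term (h h' : ℕ → ℝ → ℝ) (a : ℕ → ℝ) (r m : ℕ) (ν : ℝ) (hν : ν = -((m : ℝ) + 1))
    {t : ℝ} (hh : ∀ i, HasDerivAt (h i) (h' i t) t) (hδ : ∀ i, t * h' i t = h (i + 1) t) :
    HasDerivAt
      (fun τ : ℝ => τ ^ (m + 1) *
        ∑ j ∈ Finset.range r, (∑ i ∈ Finset.Ioo j r, a i * ν ^ (i - 1 - j)) * h j τ)
      (t ^ m * (∑ i ∈ Finset.range r, a i * h i t) -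
        (∑ i ∈ Finset.range r, a i * ν ^ i) * (t ^ m * h 0 t)) t := by
  have hS : HasDerivAt
      (fun τ : ℝ => ∑ j ∈ Finset.range r, (∑ i ∈ Finset.Ioo j r, a i * ν ^ (i - 1 - j)) * h j τ)
      (∑ j ∈ Finset.range r, (∑ i ∈ Finset.Ioo j r, a i * ν ^ (i - 1 - j)) * h' j t) t :=
    HasDerivAt.fun_sum fun j _ => (hh j).const_mul _
  have hP : HasDerivAt (fun τ : ℝ => τ ^ (m + 1)) (((m + 1 : ℕ) : ℝ) * t ^ m) t := by
    simpa using hasDerivAt_pow (m + 1) t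
  refine (hP.mul hS).congr_deriv ?_
  -- `(m+1) t^m Σ q_j h_j + t^{m+1} Σ q_j h'_j = t^m Σ q_j (h_{j+1} − ν h_j)`
  have h1 : t ^ (m + 1) * ∑ j ∈ Finset.range r, (∑ i ∈ Finset.Ioo j r, a i * ν ^ (i - 1 - j)) * h' j t =
      t ^ m * ∑ j ∈ Finset.range r, (∑ i ∈ Finset.Ioo j r, a i * ν ^ (i - 1 - j)) * h (j + 1) t := by
    rw [pow_succ, mul_assoc, Finset.mul_sum, Finset.mul_sum, Finset.mul_sum]
    refine Finset.sum_congr rfl fun j _ => ?_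
    rw [← hδ j]
    ring
  have h2 := sum_quot_identity a (fun j => h j t) ν r
  calc ((m + 1 : ℕ) : ℝ) * t ^ m *
          (∑ j ∈ Finset.range r, (∑ i ∈ Finset.Ioo j r, a i * ν ^ (i - 1 - j)) * h j t) +
        t ^ (m + 1) * ∑ j ∈ Finset.range r, (∑ i ∈ Finset.Ioo j r, a i * ν ^ (i - 1 - j)) * h' j t
      = t ^ m * ∑ j ∈ Finset.range r,
          (∑ i ∈ Finset.Ioo j r, a i * ν ^ (i - 1 - j)) * (h (j + 1) t - ν * h j t) := by
        rw [h1, Finset.mul_sum, Finset.mul_sum, Finset.mul_sum, ← Finset.sum_add_distrib]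
        refine Finset.sum_congr rfl fun j _ => ?_
        rw [hν]
        push_cast
        ring
    _ = t ^ m * (∑ i ∈ Finset.range r, a i * h i t) -
        (∑ i ∈ Finset.range r, a i * ν ^ i) * (t ^ m * h 0 t) := by
        rw [h2]
        ring

open Polynomial in
/-- **Lagrange: the quotients `(e − e(ν_u))/(X − ν_u)` weighted by `1/∏_{v≠u}(ν_u − ν_v)` sum to zero**
when `deg e < #s` and the nodes are distinct: multiply by the nodal polynomial and use
`Σ_u ℓ_u = 1`, `Σ_u e(ν_u) ℓ_u = e`. [folklore: Lagrange interpolation] -/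
theorem sum_C_mul_divByMonic_eq_zero {ι : Type*} [DecidableEq ι] (s : Finset ι) (v : ι → ℚ)
    (hvs : Set.InjOn v s) (hs : s.Nonempty) (e : ℚ[X]) (he : e.degree < s.card) :
    ∑ u ∈ s, Polynomial.C (∏ j ∈ s.erase u, (v u - v j))⁻¹ * (e /ₘ (Polynomial.X - Polynomial.C (v u))) = 0 := by
  -- the nodal polynomial
  set ω : ℚ[X] := ∏ j ∈ s, (Polynomial.X - Polynomial.C (v j)) with hω
  have hωne : ω ≠ 0 := (monic_prod_of_monic _ _ fun j _ => monic_X_sub_C (v j)).ne_zero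
  have hbasis : ∀ u ∈ s, Lagrange.basis s v u =
      Polynomial.C (∏ j ∈ s.erase u, (v u - v j))⁻¹ * ∏ j ∈ s.erase u, (Polynomial.X - Polynomial.C (v j)) := by
    intro u _
    simp only [Lagrange.basis, Lagrange.basisDivisor, Finset.prod_mul_distrib, ← map_prod,
      Finset.prod_inv_distrib]
  have hkey : ∀ u ∈ s, (Polynomial.X - Polynomial.C (v u)) * (e /ₘ (Polynomial.X - Polynomial.C (v u))) =
      e - Polynomial.C (e.eval (v u)) := by
    intro u _
    have h := modByMonic_add_div e (Polynomial.X - Polynomial.C (v u))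
    rw [modByMonic_X_sub_C_eq_C_eval] at h
    linear_combination h
  have hprod : (∑ u ∈ s, Polynomial.C (∏ j ∈ s.erase u, (v u - v j))⁻¹ *
      (e /ₘ (Polynomial.X - Polynomial.C (v u)))) * ω = 0 := by
    rw [Finset.sum_mul]
    calc ∑ u ∈ s, Polynomial.C (∏ j ∈ s.erase u, (v u - v j))⁻¹ *
            (e /ₘ (Polynomial.X - Polynomial.C (v u))) * ω
        = ∑ u ∈ s, (e - Polynomial.C (e.eval (v u))) * Lagrange.basis s v u := by
          refine Finset.sum_congr rfl fun u hu => ?_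
          rw [hbasis u hu, hω, ← Finset.mul_prod_erase s _ hu, ← hkey u hu]
          ring
      _ = e * ∑ u ∈ s, Lagrange.basis s v u -
            ∑ u ∈ s, Polynomial.C (e.eval (v u)) * Lagrange.basis s v u := by
          rw [Finset.mul_sum, ← Finset.sum_sub_distrib]
          refine Finset.sum_congr rfl fun u _ => ?_
          ring
      _ = 0 := by
          rw [Lagrange.sum_basis hvs hs, mul_one, ← Lagrange.interpolate_apply,
            ← Lagrange.eq_interpolate hvs he, sub_self]
  exact (mul_eq_zero.1 hprod).resolve_right hωne

open Polynomial in
/-- **Coefficient form of the Lagrange identity**: for distinct nodes `v u` (`u ∈ s`) and `deg e < #s`,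
`Σ_u (∏_{j≠u}(v_u − v_j))⁻¹ · Σ_{i ∈ [n+1, deg e]} (v u)^{i−(n+1)} e_i = 0` for every `n`. [folklore] -/
theorem sum_quot_coeff_eq_zero {ι : Type*} [DecidableEq ι] (s : Finset ι) (v : ι → ℚ)
    (hvs : Set.InjOn v s) (hs : s.Nonempty) (e : ℚ[X]) (he : e.degree < s.card) (n : ℕ) :
    ∑ u ∈ s, (∏ j ∈ s.erase u, (v u - v j))⁻¹ *
      ∑ i ∈ Finset.Icc (n + 1) e.natDegree, v u ^ (i - (n + 1)) * e.coeff i = 0 := by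
  have h := congrArg (fun p : ℚ[X] => p.coeff n) (sum_C_mul_divByMonic_eq_zero s v hvs hs e he)
  simpa only [Polynomial.finsetSum_coeff, Polynomial.coeff_C_mul, Polynomial.coeff_divByMonic_X_sub_C,
    Polynomial.coeff_zero] using h

open Polynomial in
/-- The weight polynomial `e_w = ∏_{v ∈ W∖w}(X + (v + c))` has degree `#W − 1`. [folklore] -/
theorem natDegree_weightPoly (W : Finset ℕ) (c w : ℕ) (hw : w ∈ W) :
    (∏ v ∈ W.erase w, (Polynomial.X + Polynomial.C ((v + c : ℕ) : ℚ))).natDegree = W.card - 1 := by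
  rw [natDegree_prod_of_monic _ _ fun v _ => monic_X_add_C _]
  simp only [natDegree_X_add_C, Finset.sum_const, smul_eq_mul, mul_one, Finset.card_erase_of_mem hw]

open Polynomial in
/-- Evaluation of the weight polynomial at a node: `e_w(−(u+c)) = ∏_{v∈W∖w}(v − u)`, which is
`0` for `u ∈ W`, `u ≠ w`. [folklore] -/
theorem eval_weightPoly (W : Finset ℕ) (c w u : ℕ) :
    (∏ v ∈ W.erase w, (Polynomial.X + Polynomial.C ((v + c : ℕ) : ℚ))).eval (-((u + c : ℕ) : ℚ)) =
      ∏ v ∈ W.erase w, ((v : ℚ) - u) := by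
  rw [Polynomial.eval_prod]
  refine Finset.prod_congr rfl fun v _ => ?_
  simp only [Polynomial.eval_add, Polynomial.eval_X, Polynomial.eval_C]
  push_cast
  ring

/-- For `u ∈ W` with `u ≠ w` the node `−(u+c)` is a root of `e_w`. [folklore] -/
theorem eval_weightPoly_of_ne (W : Finset ℕ) (c w u : ℕ) (hu : u ∈ W) (huw : u ≠ w) :
    (∏ v ∈ W.erase w, (Polynomial.X + Polynomial.C ((v + c : ℕ) : ℚ))).eval (-((u + c : ℕ) : ℚ)) = 0 := by
  rw [eval_weightPoly]
  exact Finset.prod_eq_zero (Finset.mem_erase.2 ⟨huw, hu⟩) (sub_self _)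

/-- The node products `∏_{v∈W∖u}(v − u)` do not vanish. [folklore] -/
theorem prod_sub_ne_zero (W : Finset ℕ) (u : ℕ) : ∏ v ∈ W.erase u, ((v : ℝ) - u) ≠ 0 := by
  refine Finset.prod_ne_zero_iff.2 fun v hv => ?_
  have hvu : v ≠ u := (Finset.mem_erase.1 hv).1
  exact sub_ne_zero.2 (by exact_mod_cast hvu)

end EulerTower


/-- **The Euler tower identity** (registered stub `stub_eulerTower` of the lead's skeleton, wave 13).
For a finite set of weights `W ⊂ ℕ`, an offset `c` with `u + c ≥ 1` on `W`, a fixed `w ∈ W`, and a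
`δ`-tower of functions `h_{i+1} = t·h_i'` on `[0,1]`: the function
`K_w(t) = Σ_{u∈W} t^{u+c}/c_u · Σ_j (Σ_{i>j} e_{w,i} (−(u+c))^{i−1−j}) h_j(t)` (`e_w = ∏_{v∈W∖w}(X + (v+c))`,
`c_u = ∏_{v∈W∖u}(v − u)`) has derivative `ε(t)·Σ_i e_{w,i} h_i(t) − t^{w+c−1} h_0(t)` on `[0,1]`
(`ε(t) = Σ_u t^{u+c−1}/c_u`) and vanishes at `t = 1` and at `t = 0`. This is the algebraic heart of
the multi-weight Euler telescoper: summed over `w` it reads `Σ_w t^{λ_w−1}ĵ_w = ε·ĵ_L − ∂_t K` with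
`K|_{t=0} = K|_{t=1} = 0`. [folklore: Euler operator `t d/dt`; Lagrange interpolation at the nodes `−(u+c)`] -/
theorem stub_eulerTower (W : Finset ℕ) (c w : ℕ) (hw : w ∈ W) (hW : ∀ u ∈ W, 1 ≤ u + c)
    (h h' : ℕ → ℝ → ℝ) (hh : ∀ i, ∀ t ∈ Icc (0 : ℝ) 1, HasDerivAt (h i) (h' i t) t)
    (hδ : ∀ i, ∀ t ∈ Icc (0 : ℝ) 1, t * h' i t = h (i + 1) t) :
    (∀ t ∈ Icc (0 : ℝ) 1, HasDerivAt
        (fun τ : ℝ => ∑ u ∈ W, τ ^ (u + c) / (∏ v ∈ W.erase u, ((v : ℝ) - u)) *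
          ∑ j ∈ Finset.range W.card, (∑ i ∈ Finset.Ioo j W.card,
            (((∏ v ∈ W.erase w, (Polynomial.X + Polynomial.C ((v + c : ℕ) : ℚ))).coeff i : ℚ) : ℝ) *
              (-((u + c : ℕ) : ℝ)) ^ (i - 1 - j)) * h j τ)
        ((∑ u ∈ W, t ^ (u + c - 1) / ∏ v ∈ W.erase u, ((v : ℝ) - u)) *
            (∑ i ∈ Finset.range W.card,
              (((∏ v ∈ W.erase w, (Polynomial.X + Polynomial.C ((v + c : ℕ) : ℚ))).coeff i : ℚ) : ℝ) * h i t) -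
          t ^ (w + c - 1) * h 0 t) t) ∧
    (∑ u ∈ W, (1 : ℝ) ^ (u + c) / (∏ v ∈ W.erase u, ((v : ℝ) - u)) *
          ∑ j ∈ Finset.range W.card, (∑ i ∈ Finset.Ioo j W.card,
            (((∏ v ∈ W.erase w, (Polynomial.X + Polynomial.C ((v + c : ℕ) : ℚ))).coeff i : ℚ) : ℝ) *
              (-((u + c : ℕ) : ℝ)) ^ (i - 1 - j)) * h j 1) = 0 ∧
    (∑ u ∈ W, (0 : ℝ) ^ (u + c) / (∏ v ∈ W.erase u, ((v : ℝ) - u)) *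
          ∑ j ∈ Finset.range W.card, (∑ i ∈ Finset.Ioo j W.card,
            (((∏ v ∈ W.erase w, (Polynomial.X + Polynomial.C ((v + c : ℕ) : ℚ))).coeff i : ℚ) : ℝ) *
              (-((u + c : ℕ) : ℝ)) ^ (i - 1 - j)) * h j 0) = 0 := by
  classical
  set e : Polynomial ℚ := ∏ v ∈ W.erase w, (Polynomial.X + Polynomial.C ((v + c : ℕ) : ℚ)) with he
  have hr : 0 < W.card := Finset.card_pos.2 ⟨w, hw⟩
  have hdeg : e.natDegree = W.card - 1 := EulerTower.natDegree_weightPoly W c w hw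
  have hdeg' : e.natDegree < W.card := by omega
  -- the node products over `ℝ` are the casts of those over `ℚ`, and do not vanish
  have hcc : ∀ u, ((∏ v ∈ W.erase u, ((v : ℚ) - u) : ℚ) : ℝ) = ∏ v ∈ W.erase u, ((v : ℝ) - u) := by
    intro u
    push_cast
    rfl
  have hcc0 : ∀ u, ∏ v ∈ W.erase u, ((v : ℝ) - u) ≠ 0 := EulerTower.prod_sub_ne_zero W
  -- `Σ_{i<r} e_i ν_u^i = e(ν_u)`
  have heval : ∀ u : ℕ, ∑ i ∈ Finset.range W.card, ((e.coeff i : ℚ) : ℝ) * (-((u + c : ℕ) : ℝ)) ^ i =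
      ((e.eval (-((u + c : ℕ) : ℚ)) : ℚ) : ℝ) := by
    intro u
    rw [Polynomial.eval_eq_sum_range' hdeg']
    push_cast
    rfl
  refine ⟨fun t ht => ?_, ?_, ?_⟩
  · -- the derivative, term by term
    have hterm : ∀ u ∈ W, HasDerivAt
        (fun τ : ℝ => τ ^ (u + c) / (∏ v ∈ W.erase u, ((v : ℝ) - u)) *
          ∑ j ∈ Finset.range W.card, (∑ i ∈ Finset.Ioo j W.card,
            ((e.coeff i : ℚ) : ℝ) * (-((u + c : ℕ) : ℝ)) ^ (i - 1 - j)) * h j τ)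
        ((∏ v ∈ W.erase u, ((v : ℝ) - u))⁻¹ *
          (t ^ (u + c - 1) * (∑ i ∈ Finset.range W.card, ((e.coeff i : ℚ) : ℝ) * h i t) -
            ((e.eval (-((u + c : ℕ) : ℚ)) : ℚ) : ℝ) * (t ^ (u + c - 1) * h 0 t))) t := by
      intro u hu
      have hm : u + c - 1 + 1 = u + c := Nat.sub_add_cancel (hW u hu)
      have hν : (-((u + c : ℕ) : ℝ)) = -(((u + c - 1 : ℕ) : ℝ) + 1) := by
        rw [← hm]
        push_cast
        ring
      have hD := EulerTower.hasDerivAt_term h h' (fun i => ((e.coeff i : ℚ) : ℝ)) W.card (u + c - 1)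
        (-((u + c : ℕ) : ℝ)) hν (fun i => hh i t ht) (fun i => hδ i t ht)
      rw [heval u] at hD
      have hD' := hD.const_mul (∏ v ∈ W.erase u, ((v : ℝ) - u))⁻¹
      rw [hm] at hD'
      refine hD'.congr_of_eventuallyEq (Filter.Eventually.of_forall fun τ => ?_)
      simp only [div_eq_mul_inv]
      ring
    refine (HasDerivAt.fun_sum hterm).congr_deriv ?_
    -- collect: the `h 0` parts survive only for `u = w`, where `e(ν_w)/c_w = 1`
    have hsingle : ∑ u ∈ W, (∏ v ∈ W.erase u, ((v : ℝ) - u))⁻¹ *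
        (((e.eval (-((u + c : ℕ) : ℚ)) : ℚ) : ℝ) * (t ^ (u + c - 1) * h 0 t)) =
        t ^ (w + c - 1) * h 0 t := by
      rw [Finset.sum_eq_single_of_mem w hw fun u hu huw => by
        rw [he, EulerTower.eval_weightPoly_of_ne W c w u hu huw]
        push_cast
        ring]
      rw [he, EulerTower.eval_weightPoly, hcc w, ← mul_assoc, inv_mul_cancel₀ (hcc0 w), one_mul]
    rw [← hsingle, Finset.sum_mul, ← Finset.sum_sub_distrib]
    refine Finset.sum_congr rfl fun u _ => ?_
    simp only [div_eq_mul_inv]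
    ring
  · -- `K(1) = 0`: Lagrange interpolation
    have hL := EulerTower.sum_quot_coeff_eq_zero W (fun u : ℕ => -((u + c : ℕ) : ℚ))
      (fun u _ v _ huv => by
        have : ((u + c : ℕ) : ℚ) = ((v + c : ℕ) : ℚ) := neg_injective huv
        exact_mod_cast Nat.add_right_cancel (by exact_mod_cast this : u + c = v + c))
      ⟨w, hw⟩ e (by
        rw [Polynomial.degree_eq_natDegree (Polynomial.Monic.ne_zero
          (Polynomial.monic_prod_of_monic _ _ fun v _ => Polynomial.monic_X_add_C _))]
        exact_mod_cast hdeg')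
    -- rewrite the node products and the index sets
    have hIcc : ∀ n, Finset.Icc (n + 1) e.natDegree = Finset.Ioo n W.card := by
      intro n
      ext i
      simp only [Finset.mem_Icc, Finset.mem_Ioo]
      omega
    have hnode : ∀ u, ∏ j ∈ W.erase u, (-((u + c : ℕ) : ℚ) - -((j + c : ℕ) : ℚ)) = ∏ v ∈ W.erase u, ((v : ℚ) - u) := by
      intro u
      refine Finset.prod_congr rfl fun v _ => ?_
      push_cast
      ring
    calc ∑ u ∈ W, (1 : ℝ) ^ (u + c) / (∏ v ∈ W.erase u, ((v : ℝ) - u)) *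
          ∑ j ∈ Finset.range W.card, (∑ i ∈ Finset.Ioo j W.card,
            ((e.coeff i : ℚ) : ℝ) * (-((u + c : ℕ) : ℝ)) ^ (i - 1 - j)) * h j 1
        = ∑ j ∈ Finset.range W.card, (∑ u ∈ W, (∏ v ∈ W.erase u, ((v : ℝ) - u))⁻¹ *
            ∑ i ∈ Finset.Ioo j W.card, ((e.coeff i : ℚ) : ℝ) * (-((u + c : ℕ) : ℝ)) ^ (i - 1 - j)) * h j 1 := by
          calc _ = ∑ u ∈ W, ∑ j ∈ Finset.range W.card, (1 ^ (u + c) / ∏ v ∈ W.erase u, ((v : ℝ) - u)) *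
                ((∑ i ∈ Finset.Ioo j W.card, ((e.coeff i : ℚ) : ℝ) * (-((u + c : ℕ) : ℝ)) ^ (i - 1 - j)) * h j 1) :=
                Finset.sum_congr rfl fun u _ => by rw [Finset.mul_sum]
            _ = ∑ j ∈ Finset.range W.card, ∑ u ∈ W, (1 ^ (u + c) / ∏ v ∈ W.erase u, ((v : ℝ) - u)) *
                ((∑ i ∈ Finset.Ioo j W.card, ((e.coeff i : ℚ) : ℝ) * (-((u + c : ℕ) : ℝ)) ^ (i - 1 - j)) * h j 1) :=
                Finset.sum_comm
            _ = _ := by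
                refine Finset.sum_congr rfl fun j _ => ?_
                rw [Finset.sum_mul]
                refine Finset.sum_congr rfl fun u _ => ?_
                ring
      _ = 0 := by
          refine Finset.sum_eq_zero fun j _ => ?_
          have hj := hL j
          rw [hIcc j] at hj
          have hj' : ∑ u ∈ W, (∏ v ∈ W.erase u, ((v : ℝ) - u))⁻¹ *
              ∑ i ∈ Finset.Ioo j W.card, ((e.coeff i : ℚ) : ℝ) * (-((u + c : ℕ) : ℝ)) ^ (i - 1 - j) = 0 := by
            have hcast := congrArg (fun q : ℚ => (q : ℝ)) hj
            simp only [hnode, Rat.cast_sum, Rat.cast_mul, Rat.cast_inv, Rat.cast_zero, hcc] at hcast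
            rw [← hcast]
            refine Finset.sum_congr rfl fun u _ => ?_
            congr 1
            push_cast
            refine Finset.sum_congr rfl fun i _ => ?_
            rw [show i - 1 - j = i - (j + 1) by omega]
            ring
          rw [hj', zero_mul]
  · -- `K(0) = 0`
    refine Finset.sum_eq_zero fun u hu => ?_
    have h0 : (0 : ℝ) ^ (u + c) = 0 := zero_pow (by have := hW u hu; omega)
    rw [h0, zero_div, zero_mul]

end Summit.KontsevichZagierPeriods.InverseLandau.TateFamilyKernel.Descent

end
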